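import Summits.QuantumFields.YangMills.Theorems.HypercubicLimit.Negative.NonabelianLoadBearing
import Summits.QuantumFields.QCD.Theorems.SpectralDefectExtinctionChiralDescentStubWallLimitNoGo

/-!
# Line `gap-upset-recut` of crux `SpectralDefectExtinction.ChiralDescent` (stmt-QuantumFields-17527) —
# the non-triviality clause of the QCD body IN LATTICE TERMS, and W_lim ⇐ a purely lattice decoupling statement

Support file (`--supports` stmt-QuantumFields-17527; lead c13, 2026-08-17).  Tree objects only, nothing posited;
standard axioms.

Why this file.  Every clause of the crux's antecedent `Threshold N_f` except `T.IsNontrivial (pseudoRe f g)` is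
formally compatible with a regularisation whose bare Wilson masses stay uniformly POSITIVE in lattice units
(convergent hopping expansion, every quark-sector lattice correlator gapped at a rate `≍ a_k⁻¹` in physical units),
i.e. with a regularisation no copy of which is chiral at zero.  So every proof of the crux — and every proof of the
registered wall stub W_lim (`GapUpsetRecut.stub_wallLimitNoGo`) — has to turn the OS-level non-triviality of the
flavour-changing pseudoscalar into information about honest lattice expectations.  This file does that step once:

* `tendsto_latticeTruncated` — under `IsQCDAlong sch T` the truncated smeared LATTICE two-point function of any
  species `s` on a real pair `u` (negative times) / `v` (positive times) converges to the truncated OS value on the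
  real tensors `tensor₂ u v`, `tensor₁ u`, `tensor₁ v` (the convergence clause at `n = 2` and `n = 1`; the real
  tensors are in `⁰𝒮` by `isOffDiagonal_of_halfSpaces`).
* `isNontrivial_iff_lattice` — under `IsQCDAlong sch T`: `T.IsNontrivial s` ⇔ for ONE such real pair the truncated
  lattice two-point function does NOT tend to `0` (the YM-side bridge `twoPointNontrivial_iff_real`, transported).
* `isNontrivial_iff_latticeFloor` — equivalently: an EVENTUAL FLOOR `0 < η ≤ ‖truncated lattice value‖` for all
  large `k` (the limit exists, so "not to `0`" upgrades to "eventually bounded below").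
* `latticeFloor_of_body` — the crux's body at one tuple hands every flavour-changing pseudoscalar `pseudoRe f g`,
  `f ≠ g`, such a floor along `reg.scheme m z shift`.
* `stub_wallLimitNoGo_of_latticeWallDecoupling` — the registered wall stub W_lim follows from the LATTICE-ONLY
  statement "along a mass-scaling regularisation with `m_crit(k) → −1`, whenever the smeared one- and two-point
  functions of a flavour-changing pseudoscalar converge at all, its truncated two-point function on every separated
  real pair tends to `0`" (supercritical decoupling with the OS datum eliminated — exactly what a decoupling prover has
  to show about `qcdLatticeSchwinger`; composes with `WallLimitNoGo.stub_wallLimitNoGo_of_wallDecoupling`, p154431).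
-/

noncomputable section

open scoped SchwartzMap
open Filter Topology
open Literature.MathematicalPhysics.AQFT Literature.MathematicalPhysics.QuantumLattice
open Literature.MathematicalPhysics.QuantumFieldTheory
open Summit.QuantumFields.YangMills.Theorems.HypercubicLimit.Negative (tensor₁ tensor₂ isTensorOf_tensor₁
  isTensorOf_tensor₂ isOffDiagonal_of_halfSpaces isOffDiagonal_fin_one twoPointNontrivial_iff_real)

namespace Summit.QuantumFields.QCD.Cruxes.ChiralDescent.GapUpsetRecut.LatticeNontriviality

variable {Nf : ℕ}

/-- **Convergence of the truncated smeared lattice two-point function.**  Along `IsQCDAlong sch T`, for every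
species `s` and every real pair `u` (support in `{x⁰ < 0}`), `v` (support in `{x⁰ > 0}`), the truncated lattice
two-point function `⟨Φ_k^s(u) Φ_k^s(v)⟩ − ⟨Φ_k^s(u)⟩⟨Φ_k^s(v)⟩` tends to the truncated OS value
`𝔖₂^{ss}(u ⊗ v) − 𝔖₁^s(u) 𝔖₁^s(v)`. [folklore] -/
theorem tendsto_latticeTruncated {sch : QCDScheme Nf} {T : OSData (QCDField Nf) 4} (h : IsQCDAlong sch T)
    (s : QCDField Nf) {u v : 𝓢(EuclideanSpace ℝ (Fin 4), ℝ)}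
    (hu : tsupport u ⊆ {y : EuclideanSpace ℝ (Fin 4) | y 0 < 0})
    (hv : tsupport v ⊆ {y : EuclideanSpace ℝ (Fin 4) | 0 < y 0}) :
    Tendsto (fun k : ℕ => qcdLatticeSchwinger sch k (1 + 1) (fun _ => s) ![u, v] -
        qcdLatticeSchwinger sch k 1 (fun _ => s) ![u] * qcdLatticeSchwinger sch k 1 (fun _ => s) ![v]) atTop
      (𝓝 (T.schwinger (1 + 1) (fun _ => s) (tensor₂ u v) -
        T.schwinger 1 (fun _ => s) (tensor₁ u) * T.schwinger 1 (fun _ => s) (tensor₁ v))) := by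
  have h2 := h.2.2 (1 + 1) (by norm_num) (fun _ => s) ![u, v] (tensor₂ u v) (isTensorOf_tensor₂ u v)
    (isOffDiagonal_of_halfSpaces hu hv (isTensorOf_tensor₂ u v))
  have hu1 := h.2.2 1 one_ne_zero (fun _ => s) ![u] (tensor₁ u) (isTensorOf_tensor₁ u)
    (isOffDiagonal_fin_one _)
  have hv1 := h.2.2 1 one_ne_zero (fun _ => s) ![v] (tensor₁ v) (isTensorOf_tensor₁ v)
    (isOffDiagonal_fin_one _)
  exact h2.sub (hu1.mul hv1)

/-- **Non-triviality in lattice terms (QCD schemes).**  Along `IsQCDAlong sch T`, the OS clause `T.IsNontrivial s`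
holds iff for some real pair `u` (negative times), `v` (positive times) the truncated smeared lattice two-point
function of `s` does NOT tend to `0` along the scheme. [folklore] -/
theorem isNontrivial_iff_lattice {sch : QCDScheme Nf} {T : OSData (QCDField Nf) 4} (h : IsQCDAlong sch T)
    (s : QCDField Nf) :
    T.IsNontrivial s ↔ ∃ u v : 𝓢(EuclideanSpace ℝ (Fin 4), ℝ),
      tsupport u ⊆ {y : EuclideanSpace ℝ (Fin 4) | y 0 < 0} ∧
      tsupport v ⊆ {y : EuclideanSpace ℝ (Fin 4) | 0 < y 0} ∧
      ¬ Tendsto (fun k : ℕ => qcdLatticeSchwinger sch k (1 + 1) (fun _ => s) ![u, v] -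
          qcdLatticeSchwinger sch k 1 (fun _ => s) ![u] * qcdLatticeSchwinger sch k 1 (fun _ => s) ![v])
        atTop (𝓝 0) := by
  unfold OSData.IsNontrivial
  rw [twoPointNontrivial_iff_real]
  refine exists_congr fun u => exists_congr fun v => and_congr_right fun hu =>
    and_congr_right fun hv => ?_
  have hT := tendsto_latticeTruncated h s hu hv
  constructor
  · intro hne h0
    exact hne (sub_eq_zero.1 (tendsto_nhds_unique hT h0))
  · intro hnot heq
    apply hnot
    rwa [← sub_eq_zero.2 heq]

/-- **Non-triviality as an EVENTUAL LATTICE FLOOR.**  Along `IsQCDAlong sch T`: `T.IsNontrivial s` iff for some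
real pair `u` (negative times), `v` (positive times) and some `η > 0` the truncated smeared lattice two-point
function of `s` has norm `≥ η` for all large `k` (the limit exists by `tendsto_latticeTruncated`, so "does not
tend to `0`" is the same as "eventually bounded away from `0`"). [folklore] -/
theorem isNontrivial_iff_latticeFloor {sch : QCDScheme Nf} {T : OSData (QCDField Nf) 4} (h : IsQCDAlong sch T)
    (s : QCDField Nf) :
    T.IsNontrivial s ↔ ∃ u v : 𝓢(EuclideanSpace ℝ (Fin 4), ℝ),
      tsupport u ⊆ {y : EuclideanSpace ℝ (Fin 4) | y 0 < 0} ∧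
      tsupport v ⊆ {y : EuclideanSpace ℝ (Fin 4) | 0 < y 0} ∧
      ∃ η : ℝ, 0 < η ∧ ∀ᶠ k : ℕ in atTop,
        η ≤ ‖qcdLatticeSchwinger sch k (1 + 1) (fun _ => s) ![u, v] -
          qcdLatticeSchwinger sch k 1 (fun _ => s) ![u] * qcdLatticeSchwinger sch k 1 (fun _ => s) ![v]‖ := by
  rw [isNontrivial_iff_lattice h s]
  refine exists_congr fun u => exists_congr fun v => and_congr_right fun hu =>
    and_congr_right fun hv => ?_
  have hT := tendsto_latticeTruncated h s hu hv
  set w : ℂ := T.schwinger (1 + 1) (fun _ => s) (tensor₂ u v) -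
    T.schwinger 1 (fun _ => s) (tensor₁ u) * T.schwinger 1 (fun _ => s) (tensor₁ v) with hw
  constructor
  · intro hnot
    have hw0 : w ≠ 0 := fun h0 => hnot (by rwa [h0] at hT)
    have hpos : 0 < ‖w‖ / 2 := by positivity
    refine ⟨‖w‖ / 2, hpos, ?_⟩
    have hn := hT.norm
    have hlt : ‖w‖ / 2 < ‖w‖ := by linarith [norm_pos_iff.2 hw0]
    filter_upwards [(tendsto_order.1 hn).1 _ hlt] with k hk
    exact hk.le
  · rintro ⟨η, hη, hev⟩ h0
    have hn : Tendsto (fun k : ℕ => ‖qcdLatticeSchwinger sch k (1 + 1) (fun _ => s) ![u, v] -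
        qcdLatticeSchwinger sch k 1 (fun _ => s) ![u] * qcdLatticeSchwinger sch k 1 (fun _ => s) ![v]‖)
        atTop (𝓝 0) := by
      simpa using h0.norm
    obtain ⟨k, hk, hk'⟩ := (hev.and ((tendsto_order.1 hn).2 η hη)).exists
    exact absurd (lt_of_le_of_lt hk hk') (lt_irrefl _)

/-- **The body of the crux hands every flavour-changing pseudoscalar a lattice floor.**  If a tuple carries the
QCD body along `reg.scheme m z shift` (only `IsQCDAlong` and the dynamical-quark clause are used), then for every
`f ≠ g` some real pair `u` (negative times), `v` (positive times) has the truncated smeared lattice two-point function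
of `Re ψ̄_f iγ₅ ψ_g` eventually bounded below in norm by some `η > 0`. [folklore] -/
theorem latticeFloor_of_body (reg : QCDRegularisation Nf) (m : Fin Nf → ℝ) (z shift : QCDField Nf → ℕ → ℝ)
    (T : OSData (QCDField Nf) 4) (hQ : IsQCDAlong (reg.scheme m z shift) T)
    (hP : ∀ f g : Fin Nf, f ≠ g → T.IsNontrivial (QCDField.pseudoRe f g)) {f g : Fin Nf} (hfg : f ≠ g) :
    ∃ u v : 𝓢(EuclideanSpace ℝ (Fin 4), ℝ),
      tsupport u ⊆ {y : EuclideanSpace ℝ (Fin 4) | y 0 < 0} ∧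
      tsupport v ⊆ {y : EuclideanSpace ℝ (Fin 4) | 0 < y 0} ∧
      ∃ η : ℝ, 0 < η ∧ ∀ᶠ k : ℕ in atTop,
        η ≤ ‖qcdLatticeSchwinger (reg.scheme m z shift) k (1 + 1) (fun _ => QCDField.pseudoRe f g) ![u, v] -
          qcdLatticeSchwinger (reg.scheme m z shift) k 1 (fun _ => QCDField.pseudoRe f g) ![u] *
            qcdLatticeSchwinger (reg.scheme m z shift) k 1 (fun _ => QCDField.pseudoRe f g) ![v]‖ :=
  (isNontrivial_iff_latticeFloor hQ _).1 (hP f g hfg)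

/-- **W_lim ⇐ LATTICE WALL DECOUPLING (registered sub-goal `stub_wallLimitNoGo_of_latticeWallDecoupling` of
stmt-QuantumFields-17527).**  Hypothesis `hL` — supercritical decoupling stated on honest lattice expectations only,
the OS datum eliminated: for `N_f ∈ {2,3}`, along a mass-scaling regularisation with `m_crit(k) → −1`, at every tuple
and for all species renormalisations, every flavour-changing pseudoscalar `Re ψ̄_f iγ₅ ψ_g` (`f ≠ g`) whose smeared
lattice one- and two-point functions on a separated real pair `u ⊗ v` converge at all has truncated two-point function
tending to `0`.  Conclusion: VERBATIM the registered `stub_wallLimitNoGo` (through `isNontrivial_iff_lattice` and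
`WallLimitNoGo.stub_wallLimitNoGo_of_wallDecoupling`).  `hL` is open (localisation of the supercritical near-zero modes
of the Wilson–Dirac operator at bare mass `→ −1`; no theorem or named fact of the tree). [folklore] -/
theorem stub_wallLimitNoGo_of_latticeWallDecoupling : (∀ Nf : ℕ, (Nf = 2 ∨ Nf = 3) → ∀ reg : QCDRegularisation Nf, reg.HasMassScaling → Tendsto reg.mcrit atTop (nhds (-1)) → ∀ (m : Fin Nf → ℝ) (z shift : QCDField Nf → ℕ → ℝ) (f g : Fin Nf), f ≠ g → ∀ u v : SchwartzMap (EuclideanSpace ℝ (Fin 4)) ℝ, tsupport u ⊆ {y : EuclideanSpace ℝ (Fin 4) | y 0 < 0} → tsupport v ⊆ {y : EuclideanSpace ℝ (Fin 4) | 0 < y 0} → (∃ c₂ : ℂ, Tendsto (fun k : ℕ => qcdLatticeSchwinger (reg.scheme m z shift) k (1 + 1) (fun _ => QCDField.pseudoRe f g) ![u, v]) atTop (nhds c₂)) → (∃ c₁ : ℂ, Tendsto (fun k : ℕ => qcdLatticeSchwinger (reg.scheme m z shift) k 1 (fun _ => QCDField.pseudoRe f g) ![u]) atTop (nhds c₁))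 → (∃ c₁' : ℂ, Tendsto (fun k : ℕ => qcdLatticeSchwinger (reg.scheme m z shift) k 1 (fun _ => QCDField.pseudoRe f g) ![v]) atTop (nhds c₁')) → Tendsto (fun k : ℕ => qcdLatticeSchwinger (reg.scheme m z shift) k (1 + 1) (fun _ => QCDField.pseudoRe f g) ![u, v] - qcdLatticeSchwinger (reg.scheme m z shift) k 1 (fun _ => QCDField.pseudoRe f g) ![u] * qcdLatticeSchwinger (reg.scheme m z shift) k 1 (fun _ => QCDField.pseudoRe f g) ![v]) atTop (nhds 0)) → ∀ Nf : ℕ, (Nf = 2 ∨ Nf = 3) → ∀ reg : QCDRegularisation Nf, reg.HasMassScaling → Tendsto reg.mcrit atTop (nhds (-1)) → ∀ μ : ℝ, ¬ ∀ m : Fin Nf → ℝ, (∀ f, μ < m f) → ∃ (z shift : QCDField Nf → ℕ → ℝ) (T : OSData (QCDField Nf) 4), IsQCDAlong (reg.scheme m z shift) T ∧ T.IsNontrivial QCDField.glue ∧ T.IsNonGaussian QCDField.glue ∧ (∀ f g : Fin Nf, f ≠ g → T.IsNontrivial (QCDField.pseudoRe f g)) ∧ ∃ Δ > 0, T.HasMassGap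 Δ ∧ (reg.scheme m z shift).HasLatticeMassGap Δ := by
  intro hL
  refine WallLimitNoGo.stub_wallLimitNoGo_of_wallDecoupling fun Nf hNf reg hMS hwall m z shift T hQ f g hfg hN => ?_
  obtain ⟨u, v, hu, hv, hnot⟩ := (isNontrivial_iff_lattice hQ _).1 hN
  refine hnot (hL Nf hNf reg hMS hwall m z shift f g hfg u v hu hv ?_ ?_ ?_)
  · exact ⟨_, hQ.2.2 (1 + 1) (by norm_num) (fun _ => QCDField.pseudoRe f g) ![u, v] (tensor₂ u v)
      (isTensorOf_tensor₂ u v) (isOffDiagonal_of_halfSpaces hu hv (isTensorOf_tensor₂ u v))⟩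
  · exact ⟨_, hQ.2.2 1 one_ne_zero (fun _ => QCDField.pseudoRe f g) ![u] (tensor₁ u) (isTensorOf_tensor₁ u)
      (isOffDiagonal_fin_one _)⟩
  · exact ⟨_, hQ.2.2 1 one_ne_zero (fun _ => QCDField.pseudoRe f g) ![v] (tensor₁ v) (isTensorOf_tensor₁ v)
      (isOffDiagonal_fin_one _)⟩

end Summit.QuantumFields.QCD.Cruxes.ChiralDescent.GapUpsetRecut.LatticeNontriviality

end
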